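import Literature.MathematicalPhysics.QuantumFieldTheory.Balaban1983to89.T4ShellMeasureFibre
import Literature.MathematicalPhysics.QuantumFieldTheory.Balaban1983to89.B15BasicStep

/-!
# N21 (NE7c) · IMPLIED LETTERS ARE DEAD BY PRINTED MARGIN; affine implications transfer shells (lens Cards 72, 75, 76 ∕ ROW E′)

R134 seat pub-ymgap-dag-n21-d (g8), node N21 = NE7c (single-run shell-weight bound, NOT PRINTED in [Bałaban 1983–89],
NOT proved), lane K3⁷ `SpineGivenEndpointR13SepCoPH` (stmt-QuantumFields-20544, `--kind proof --supports … --as helper`).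
Part 23 of the comparison series.  THIS FILE = LENS ROW E′ of `ym-lens-BalabanUVNodes-nearmiss/LENS-nearmiss.md` v26.0
(first refusal dag-n21-d): §A–§C of the lens's `Sketch-nearmiss-g25.lean` and §A–§B of `Sketch-nearmiss-g26.lean` (farm
rc 0 · 0 warnings at the lens desk) VERBATIM — statements and proofs — re-homed in this namespace (the g26 sections are
prefixed «§26A ∕ §26B» in the section banners only).  AUTHORSHIP OF THE MATHEMATICS: planner seat `ym-lens-BalabanUVNodes-nearmiss` g25∕g26; this seat only files.

WHAT (lens words).  «[LF-I] p.183: the new characteristic functions imply (1.3), (1.4), (1.5), (1.7), (1.8),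
χ_k^{(n)} = 1.  With margin m < 1 ((1.31): ≤ 1 − β∕20; (1.43): ¼ + o; (1.52): ≤ 113∕192) the implied letter's shell is
EMPTY below depth 1 − m: (M1) with the printed number 1∕(1−m).  With margin exactly 0 — print's α = 1∕8 on the
Z″-lines ((1.50), `coeff150_le_coeff149_iff`) and the (1.8) chain with its ½δ_j roundings — the implication
u ≤ a v + c puts shell_u(ρ) inside shell_v(θ_uρ∕(aθ_v)) on the term's support: (M1)_u = (M1)_v × θ_u∕(aθ_v) (Z″ rung
≤ 1 + 2^{−(j−i)}∕4, ladder ≤ e^{1∕2}; (1.8) ↦ (1.9): × 2).  No fibre, no centre, no N₀.»  (`…_uniform` = rung arithmetic, NOT K-uniformity: N168.)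

HONEST FRAMING.  [folklore] arithmetic ∕ monotonicity of measures; located numbers are displayed hypotheses or quoted printed margins; 0 def, 0 sorry;
nothing of Bałaban's asserted; NE7c NOT PRINTED ∕ NOT proved; N21 NOT discharged; counts unmoved (5∕27); count-neutral; one finite 𝕋⁴ — not ℝ⁴ ∕ OS ∕ Clay.
-/

open MeasureTheory Set
open scoped ENNReal
open Literature.MathematicalPhysics.QuantumFieldTheory.Balaban1983to89
open Literature.MathematicalPhysics.QuantumFieldTheory.Balaban1983to89.T4ShellMeasure

namespace Summit.QuantumFields.YangMills.Theorems.N21ImpliedLetters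

open Literature.MathematicalPhysics.QuantumFieldTheory.Balaban1983to89.T4ShellMeasure
  (SlotAntiConcentration slot_field_of_antiConcentration)

/-! ## §A  Dead slots: printed margins decide liveness (Card 72) -/

/-- Levels with `D ρ ≥ 1` are free: (M1) is implied by monotonicity of the measure. -/
theorem slotAntiConcentration_of_one_le {Ω : Type*} [MeasurableSpace Ω] (μ : Measure Ω) (u : Ω → ℝ)
    {θ ρ D : ℝ} (h : 1 ≤ D * ρ) : SlotAntiConcentration μ u θ ρ D := by
  unfold SlotAntiConcentration
  calc μ {x | θ * (1 - ρ) ≤ u x ∧ u x < θ} ≤ μ Set.univ := measure_mono (subset_univ _)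
    _ = 1 * μ Set.univ := (one_mul _).symm
    _ ≤ ENNReal.ofReal (D * ρ) * μ Set.univ := by
        gcongr
        exact ENNReal.one_le_ofReal.2 h

/-- An empty shell satisfies (M1) with any constant. -/
theorem slotAntiConcentration_of_shell_null {Ω : Type*} [MeasurableSpace Ω] {μ : Measure Ω} {u : Ω → ℝ}
    {θ ρ : ℝ} (D : ℝ) (h : μ {x | θ * (1 - ρ) ≤ u x ∧ u x < θ} = 0) :
    SlotAntiConcentration μ u θ ρ D := by
  unfold SlotAntiConcentration
  rw [h]
  exact zero_le

/-- **DEAD-SLOT LEMMA.**  If the cut law charges NO configuration with `θ·m ≤ u < θ` (the slot's letter is implied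
WITH MARGIN `m < 1` by a letter present in the law — [LF-I] p. 183 + (1.31)), then (M1) holds at EVERY relative
depth `ρ` with the constant `D = 1∕(1 − m)`: for `ρ < 1 − m` the shell is empty, for `ρ ≥ 1 − m` one has `Dρ ≥ 1`. -/
theorem slotAntiConcentration_of_margin {Ω : Type*} [MeasurableSpace Ω] {μ : Measure Ω} {u : Ω → ℝ}
    {θ m ρ : ℝ} (hθ : 0 ≤ θ) (hm : m < 1) (hband : μ {x | θ * m ≤ u x ∧ u x < θ} = 0) :
    SlotAntiConcentration μ u θ ρ (1 / (1 - m)) := by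
  rcases lt_or_ge ρ (1 - m) with h | h
  · apply slotAntiConcentration_of_shell_null
    refine measure_mono_null (fun x hx => ?_) hband
    exact ⟨le_trans (mul_le_mul_of_nonneg_left (by linarith) hθ) hx.1, hx.2⟩
  · apply slotAntiConcentration_of_one_le
    rw [one_div, ← div_eq_inv_mul, le_div_iff₀ (sub_pos.2 hm)]
    linarith

/-- The same on the cut law `μ|S` of an implying letter: if `u < θ·m` on `S` (e.g. `S = {v < θ'}` with the printed
implication `v < θ' ⇒ u < m θ`), the slot is dead with `D = 1∕(1 − m)`. -/
theorem slotAntiConcentration_restrict_of_implied {Ω : Type*} [MeasurableSpace Ω] {μ : Measure Ω}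
    {u : Ω → ℝ} {θ m ρ : ℝ} (hθ : 0 ≤ θ) (hm : m < 1) {S : Set Ω} (hS : MeasurableSet S)
    (himp : ∀ x ∈ S, u x < θ * m) :
    SlotAntiConcentration (μ.restrict S) u θ ρ (1 / (1 - m)) := by
  apply slotAntiConcentration_of_margin hθ hm
  rw [Measure.restrict_apply' hS]
  refine measure_mono_null ?_ (measure_empty (μ := μ))
  rintro x ⟨hx, hxS⟩
  exact (not_lt.2 hx.1 (himp x hxS)).elim

/-- **THE SLOT-LEDGER FIELD OF A DEAD SLOT** (knit with `T4ShellMeasure.slot_field_of_antiConcentration`, the shape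
of `N21DilationHazard.slot_field_of_homogeneous`): level constant `D = 1∕(1 − m)`, a printed number. -/
theorem slot_field_of_margin {Ω ι : Type*} [MeasurableSpace Ω] {μ : Measure Ω} [IsFiniteMeasure μ]
    {u : Ω → ℝ} {θ m ρ : ℝ} (hθ : 0 ≤ θ) (hm : m < 1) (hρ : 0 ≤ ρ) {S : Set Ω} (hS : MeasurableSet S)
    (himp : ∀ x ∈ S, u x < θ * m) (T : Finset ι) {piece A : ι → ℝ} {M : ℝ} (hM : 0 ≤ M)
    (hpiece : ∑ τ ∈ T, piece τ ≤ M * ((μ.restrict S) {x | θ * (1 - ρ) ≤ u x ∧ u x < θ}).toReal)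
    (hA : M * ((μ.restrict S) Set.univ).toReal ≤ ∑ τ ∈ T, A τ) :
    ∑ τ ∈ T, piece τ ≤ (1 / (1 - m) * ρ) * ∑ τ ∈ T, A τ :=
  slot_field_of_antiConcentration (div_nonneg zero_le_one (by linarith)) hρ
    (slotAntiConcentration_restrict_of_implied hθ hm hS himp) T hM hpiece hA

/-! ## §B  The pure ladder arithmetic ([LF-I] (1.22)–(1.24)) -/

/-- Rung factors `c(t) = 1 − β(1 − t)`, `t = q^{−m}`: `c(t∕q) ≤ (1 − β t (1 − 1∕q))·c(t)`. -/
theorem ladder_margin {β t q : ℝ} (hβ : 0 ≤ β) (ht0 : 0 ≤ t) (ht1 : t ≤ 1) (hq : 1 ≤ q) :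
    1 - β * (1 - t / q) ≤ (1 - β * t * (1 - 1 / q)) * (1 - β * (1 - t)) := by
  have hq' : 1 / q ≤ 1 := by rw [div_le_one (by linarith)]; exact hq
  have hb : 0 ≤ β * t * (1 - 1 / q) := mul_nonneg (mul_nonneg hβ ht0) (by linarith)
  have hc : 0 ≤ β * (1 - t) := mul_nonneg hβ (by linarith)
  have key : (1 - β * t * (1 - 1 / q)) * (1 - β * (1 - t)) - (1 - β * (1 - t / q))
      = (β * t * (1 - 1 / q)) * (β * (1 - t)) := by ring
  nlinarith [mul_nonneg hb hc, key]

/-- The newer rung's threshold over the older one: `c_{m+1}∕c_m ≤ 1 − β q^{−m}(1 − 1∕q)`. -/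
theorem ladder_ratio_le {β t q : ℝ} (hβ : 0 ≤ β) (ht0 : 0 ≤ t) (ht1 : t ≤ 1) (hq : 1 ≤ q)
    (hc : 0 < 1 - β * (1 - t)) :
    (1 - β * (1 - t / q)) / (1 - β * (1 - t)) ≤ 1 - β * t * (1 - 1 / q) := by
  rw [div_le_iff₀ hc]
  exact ladder_margin hβ ht0 ht1 hq

/-- Dead-slot constant of a ladder rung: margin `m' ≤ 1 − β t (1 − 1∕q)` gives `1∕(1 − m') ≤ 1∕(β t (1 − 1∕q))`. -/
theorem ladder_slotConstant_le {β t q m' : ℝ} (hβ : 0 < β) (ht : 0 < t) (hq : 1 < q)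
    (hm' : m' ≤ 1 - β * t * (1 - 1 / q)) : 1 / (1 - m') ≤ 1 / (β * t * (1 - 1 / q)) := by
  have hq' : 1 / q < 1 := by rw [div_lt_one (by linarith)]; exact hq
  have hb : 0 < β * t * (1 - 1 / q) := mul_pos (mul_pos hβ ht) (by linarith)
  exact one_div_le_one_div_of_le hb (by linarith)

/-- arithmetic: `1∕(β·Q⁻¹·c) = Q∕(β·c)`. [folklore] -/
theorem one_div_mul_inv_mul (β Q c : ℝ) : 1 / (β * Q⁻¹ * c) = Q / (β * c) := by
  rw [one_div, mul_inv, mul_inv, inv_inv, div_eq_mul_inv, mul_inv]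
  ring

/-- … with `t = q^{−m}`: `D_m ≤ q^m ∕ (β(1 − 1∕q))` (`= 2^{m+1}∕β` for the printed `q = 2`). -/
theorem ladder_slotConstant_pow {β q m' : ℝ} (m : ℕ) (hβ : 0 < β) (hq : 1 < q)
    (hm' : m' ≤ 1 - β * (q ^ m)⁻¹ * (1 - 1 / q)) : 1 / (1 - m') ≤ q ^ m / (β * (1 - 1 / q)) := by
  have hqm : 0 < q ^ m := pow_pos (by linarith) m
  calc 1 / (1 - m') ≤ 1 / (β * (q ^ m)⁻¹ * (1 - 1 / q)) := ladder_slotConstant_le hβ (inv_pos.2 hqm) hq hm'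
    _ = q ^ m / (β * (1 - 1 / q)) := one_div_mul_inv_mul _ _ _

/-- Uniformity in `K`: only `m ≤ N₀` rungs overlap ([LF-I] p. 181, `k₀ = k − N₀`), so every ladder slot has
`D ≤ q^{N₀}∕(β(1 − 1∕q))`. -/
theorem ladder_slotConstant_uniform {β q m' : ℝ} {m N₀ : ℕ} (hmN : m ≤ N₀) (hβ : 0 < β) (hq : 1 < q)
    (hm' : m' ≤ 1 - β * (q ^ m)⁻¹ * (1 - 1 / q)) : 1 / (1 - m') ≤ q ^ N₀ / (β * (1 - 1 / q)) := by
  have hq' : 1 / q < 1 := by rw [div_lt_one (by linarith)]; exact hq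
  refine (ladder_slotConstant_pow m hβ hq hm').trans ?_
  exact div_le_div_of_nonneg_right (pow_le_pow_right₀ hq.le hmN) (mul_pos hβ (by linarith)).le

/-! ## §C  The located first-rung margin: [LF-I] (1.31), p. 184 -/

/-- (1.31): `|U_{j,□}(∂p) − 1| < (1 − β∕2 + (2β∕10)L⁻² + 4β∕10)·ε_jξ²`; for `L ≥ 2` the factor is `≤ 1 − β∕20`. -/
theorem margin131_le {β L : ℝ} (hβ : 0 ≤ β) (hL : 2 ≤ L) :
    1 - β / 2 + (2 * β / 10) / L ^ 2 + 4 * β / 10 ≤ 1 - β / 20 := by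
  have h4 : (4 : ℝ) ≤ L ^ 2 := by nlinarith
  have h := div_le_div_of_nonneg_left (by positivity : 0 ≤ 2 * β / 10) (by norm_num : (0 : ℝ) < 4) h4
  linarith

/-- … hence the dead-slot constant of a (1.3)-letter implied through (1.31) is `≤ 20∕β`, uniform in `K, j, L`. -/
theorem margin131_slotConstant {β L m : ℝ} (hβ : 0 < β) (hL : 2 ≤ L)
    (hm : m ≤ 1 - β / 2 + (2 * β / 10) / L ^ 2 + 4 * β / 10) : 1 / (1 - m) ≤ 20 / β := by
  have h := margin131_le hβ.le hL
  calc 1 / (1 - m) ≤ 1 / (β / 20) := one_div_le_one_div_of_le (by positivity) (by linarith)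
    _ = 20 / β := one_div_div _ _

/-! ## §26A  The Z″-line near-miss: margin `β s (1/4 − 2α)` -/

/-- Strict companion of `B15.BasicStep.coeff150_le_coeff149_iff`: the (1.50) ⇒ (1.49) margin is POSITIVE iff
`α < 1/8`; print takes `8α ≤ 1`, i.e. allows margin exactly `0`. [cite: Balaban1989LargeFieldI, (1.50) p.187] -/
theorem coeff150_lt_coeff149_iff {α β s : ℝ} (hβ : 0 < β) (hs : 0 < s) :
    1 - β * (1 - s / 4) + 2 * α * β * s < 1 - β * (1 - s / 2) ↔ α < 1 / 8 := by
  have hβs : 0 < β * s := mul_pos hβ hs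
  constructor
  · intro h; nlinarith
  · intro h; nlinarith

/-- The margin in closed form: `c₁₄₉ − c₁₅₀ = β s (1/4 − 2α)`. -/
theorem zline_margin_eq (α β s : ℝ) :
    (1 - β * (1 - s / 2)) - (1 - β * (1 - s / 4) + 2 * α * β * s) = β * s * (1 / 4 - 2 * α) := by ring

/-- The RELATIVE implication margin of a Z″-line letter: `m = c₁₅₀∕c₁₄₉ ≤ 1 − β s (1/4 − 2α)` (`c₁₄₉ ≤ 1`).  With
`α < 1/8` the g25 dead-slot lemma (`slotAntiConcentration_of_margin`, Sketch-g25 §A) then gives (M1) with the level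
constant `D = 1∕(β s (1/4 − 2α)) = 2^{j−i}∕(β(1/4 − 2α))`; at print's `α = 1/8` it gives NOTHING — see §B. -/
theorem zline_relMargin_le {α β s : ℝ} (hα : α ≤ 1 / 8) (hβ0 : 0 ≤ β) (hβ1 : β < 1) (hs0 : 0 ≤ s)
    (hs1 : s ≤ 1) :
    (1 - β * (1 - s / 4) + 2 * α * β * s) / (1 - β * (1 - s / 2)) ≤ 1 - β * s * (1 / 4 - 2 * α) := by
  have hc : 0 < 1 - β * (1 - s / 2) := by nlinarith
  rw [div_le_iff₀ hc]
  have hm : 0 ≤ β * s * (1 / 4 - 2 * α) := by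
    apply mul_nonneg (mul_nonneg hβ0 hs0); linarith
  have hc1 : 1 - β * (1 - s / 2) ≤ 1 := by nlinarith
  have key : β * s * (1 / 4 - 2 * α) * (1 - β * (1 - s / 2)) ≤ β * s * (1 / 4 - 2 * α) := by
    calc β * s * (1 / 4 - 2 * α) * (1 - β * (1 - s / 2))
        ≤ β * s * (1 / 4 - 2 * α) * 1 := mul_le_mul_of_nonneg_left hc1 hm
      _ = β * s * (1 / 4 - 2 * α) := mul_one _
  linarith [key]

/-! ## §26B  Affine implications transfer shells (Card 76) -/

/-- **SHELL TRANSFER ALONG AN AFFINE IMPLICATION.**  On a set `S` where the implying letter holds (`v < θ_v`) and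
the printed implication inequality `u ≤ a·v + c` holds (`a > 0`; in [LF-I] (1.48) `S` = the support of the newer
characteristic function and of the fluctuation restrictions), with thresholds satisfying `a·θ_v + c ≤ θ_u` (ANY
margin `≤ 1`, zero included), the `u`-shell of relative depth `ρ` lies inside the `v`-shell of relative depth
`θ_u ρ∕(a θ_v)`. [folklore] -/
theorem shell_inter_subset_shell_of_affineOn {X : Type*} (u v : X → ℝ) {S : Set X} {a c θu θv ρ : ℝ}
    (ha : 0 < a) (hθv : 0 < θv) (himp : ∀ x ∈ S, v x < θv ∧ u x ≤ a * v x + c) (hm : a * θv + c ≤ θu) :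
    ({x | θu * (1 - ρ) ≤ u x ∧ u x < θu} ∩ S)
      ⊆ {x | θv * (1 - θu * ρ / (a * θv)) ≤ v x ∧ v x < θv} := by
  rintro x ⟨⟨h1, _⟩, hx⟩
  obtain ⟨hv, hle⟩ := himp x hx
  refine ⟨?_, hv⟩
  have key : a * θv - θu * ρ ≤ a * v x := by linarith
  have hane : a ≠ 0 := ha.ne'
  have hθne : θv ≠ 0 := hθv.ne'
  have e1 : θv * (1 - θu * ρ / (a * θv)) = (a * θv - θu * ρ) / a := by
    field_simp
  rw [e1, div_le_iff₀ ha]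
  linarith [key]

/-- The same with an implication DEFECT `e ≥ 0` (`a·θ_v + c ≤ θ_u(1 + e)`, e.g. after an independent lowering of the
two thresholds — node U1b's selected thresholds): the target shell has relative depth `θ_u (ρ + e)∕(a θ_v)`.
[folklore] -/
theorem shell_inter_subset_shell_of_affineOn_defect {X : Type*} (u v : X → ℝ) {S : Set X}
    {a c θu θv ρ e : ℝ} (ha : 0 < a) (hθv : 0 < θv) (himp : ∀ x ∈ S, v x < θv ∧ u x ≤ a * v x + c)
    (hm : a * θv + c ≤ θu * (1 + e)) :
    ({x | θu * (1 - ρ) ≤ u x ∧ u x < θu} ∩ S)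
      ⊆ {x | θv * (1 - θu * (ρ + e) / (a * θv)) ≤ v x ∧ v x < θv} := by
  rintro x ⟨⟨h1, _⟩, hx⟩
  obtain ⟨hv, hle⟩ := himp x hx
  refine ⟨?_, hv⟩
  have key : a * θv - θu * (ρ + e) ≤ a * v x := by linarith
  have hane : a ≠ 0 := ha.ne'
  have hθne : θv ≠ 0 := hθv.ne'
  have e1 : θv * (1 - θu * (ρ + e) / (a * θv)) = (a * θv - θu * (ρ + e)) / a := by
    field_simp
  rw [e1, div_le_iff₀ ha]
  linarith [key]

/-- **(M1) TRANSFER.**  On a law `μ` carried by `S` (`μ Sᶜ = 0`: the term contains the implying letter and the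
restrictions under which the implication inequality is printed), (M1) for `v` at `(θ_v, θ_u ρ∕(a θ_v), D)` gives
(M1) for the implied statistic `u` at `(θ_u, ρ, D·θ_u∕(a θ_v))` — NO margin needed, NO analytic input on `u`.
[folklore] -/
theorem slotAntiConcentration_of_affine_implication {X : Type*} [MeasurableSpace X] {μ : Measure X}
    (u v : X → ℝ) {S : Set X} {a c θu θv ρ D : ℝ} (ha : 0 < a) (hθv : 0 < θv)
    (himp : ∀ x ∈ S, v x < θv ∧ u x ≤ a * v x + c) (hm : a * θv + c ≤ θu) (hS : μ Sᶜ = 0)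
    (hv : SlotAntiConcentration μ v θv (θu * ρ / (a * θv)) D) :
    SlotAntiConcentration μ u θu ρ (D * (θu / (a * θv))) := by
  unfold SlotAntiConcentration at hv ⊢
  have hsplit : {x | θu * (1 - ρ) ≤ u x ∧ u x < θu}
      ⊆ ({x | θu * (1 - ρ) ≤ u x ∧ u x < θu} ∩ S) ∪ Sᶜ := by
    intro x hx
    by_cases h : x ∈ S
    · exact Or.inl ⟨hx, h⟩
    · exact Or.inr h
  calc μ {x | θu * (1 - ρ) ≤ u x ∧ u x < θu}
      ≤ μ (({x | θu * (1 - ρ) ≤ u x ∧ u x < θu} ∩ S) ∪ Sᶜ) := measure_mono hsplit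
    _ ≤ μ ({x | θu * (1 - ρ) ≤ u x ∧ u x < θu} ∩ S) + μ Sᶜ := measure_union_le _ _
    _ = μ ({x | θu * (1 - ρ) ≤ u x ∧ u x < θu} ∩ S) := by rw [hS, add_zero]
    _ ≤ μ {x | θv * (1 - θu * ρ / (a * θv)) ≤ v x ∧ v x < θv} :=
        measure_mono (shell_inter_subset_shell_of_affineOn u v ha hθv himp hm)
    _ ≤ ENNReal.ofReal (D * (θu * ρ / (a * θv))) * μ Set.univ := hv
    _ = ENNReal.ofReal (D * (θu / (a * θv)) * ρ) * μ Set.univ := by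
        congr 2; ring

/-- The same on the CUT LAW `ν|S` (the shape of the term laws of [LF-I] §1, where the newest characteristic
functions and the fluctuation restrictions are factors). [folklore] -/
theorem slotAntiConcentration_restrict_of_affine_implication {X : Type*} [MeasurableSpace X]
    {ν : Measure X} (u v : X → ℝ) {S : Set X} {a c θu θv ρ D : ℝ} (ha : 0 < a) (hθv : 0 < θv)
    (himp : ∀ x ∈ S, v x < θv ∧ u x ≤ a * v x + c) (hm : a * θv + c ≤ θu) (hSm : MeasurableSet S)
    (hv : SlotAntiConcentration (ν.restrict S) v θv (θu * ρ / (a * θv)) D) :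
    SlotAntiConcentration (ν.restrict S) u θu ρ (D * (θu / (a * θv))) := by
  refine slotAntiConcentration_of_affine_implication u v ha hθv himp hm ?_ hv
  rw [Measure.restrict_apply' hSm, Set.compl_inter_self, measure_empty]

/-- **(M1) TRANSFER WITH DEFECT** `e ≥ 0` and `ρ > 0`: constant `D·(θ_u∕(a θ_v))·((ρ + e)∕ρ)` — an implication
defect must be `O(ρ)` (cf. `N21SelectedThresholdsTransport.box_admissible`: room `r ≥ κ`). [folklore] -/
theorem slotAntiConcentration_of_affine_defect {X : Type*} [MeasurableSpace X] {μ : Measure X}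
    (u v : X → ℝ) {S : Set X} {a c θu θv ρ e D : ℝ} (ha : 0 < a) (hθv : 0 < θv) (hρ : 0 < ρ)
    (himp : ∀ x ∈ S, v x < θv ∧ u x ≤ a * v x + c) (hm : a * θv + c ≤ θu * (1 + e)) (hS : μ Sᶜ = 0)
    (hv : SlotAntiConcentration μ v θv (θu * (ρ + e) / (a * θv)) D) :
    SlotAntiConcentration μ u θu ρ (D * (θu / (a * θv)) * ((ρ + e) / ρ)) := by
  unfold SlotAntiConcentration at hv ⊢
  have hsplit : {x | θu * (1 - ρ) ≤ u x ∧ u x < θu}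
      ⊆ ({x | θu * (1 - ρ) ≤ u x ∧ u x < θu} ∩ S) ∪ Sᶜ := by
    intro x hx
    by_cases h : x ∈ S
    · exact Or.inl ⟨hx, h⟩
    · exact Or.inr h
  have hρ0 : ρ ≠ 0 := hρ.ne'
  have hane : a ≠ 0 := ha.ne'
  have hθne : θv ≠ 0 := hθv.ne'
  have e1 : D * (θu / (a * θv)) * ((ρ + e) / ρ) * ρ = D * (θu * (ρ + e) / (a * θv)) := by
    field_simp
  calc μ {x | θu * (1 - ρ) ≤ u x ∧ u x < θu}
      ≤ μ (({x | θu * (1 - ρ) ≤ u x ∧ u x < θu} ∩ S) ∪ Sᶜ) := measure_mono hsplit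
    _ ≤ μ ({x | θu * (1 - ρ) ≤ u x ∧ u x < θu} ∩ S) + μ Sᶜ := measure_union_le _ _
    _ = μ ({x | θu * (1 - ρ) ≤ u x ∧ u x < θu} ∩ S) := by rw [hS, add_zero]
    _ ≤ μ {x | θv * (1 - θu * (ρ + e) / (a * θv)) ≤ v x ∧ v x < θv} :=
        measure_mono (shell_inter_subset_shell_of_affineOn_defect u v ha hθv himp hm)
    _ ≤ ENNReal.ofReal (D * (θu * (ρ + e) / (a * θv))) * μ Set.univ := hv
    _ = ENNReal.ofReal (D * (θu / (a * θv)) * ((ρ + e) / ρ) * ρ) * μ Set.univ := by rw [e1]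

/-- **THE Z″ RUNG IS AN AFFINE IMPLICATION WITH MARGIN ≤ 1** ([LF-I] (1.48) = `B15.BasicStep.Ineq148`:
`u ≤ v(1 + αβs) + αβsE`, thresholds `θ_v = (1 − β(1 − s/4))PE` (level `n+1`, `SF149 · β (s/4) P E`) and
`θ_u = (1 − β(1 − s/2))PE` (level `n`)): for `0 ≤ α ≤ 1/8`, `0 ≤ β ≤ 1`, `0 ≤ s ≤ 1`, `P ≥ 1`, `E ≥ 0` one has
`(1 + αβs)θ_v + αβsE ≤ θ_u` — print's `8α ≤ 1` INCLUDED (margin zero allowed). [cite: Balaban1989LargeFieldI, (1.48)–(1.50) p.187] -/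
theorem zrung_affine_margin {α β s P E : ℝ} (hα : 0 ≤ α) (hα8 : α ≤ 1 / 8) (hβ0 : 0 ≤ β) (hβ1 : β ≤ 1)
    (hs0 : 0 ≤ s) (hs1 : s ≤ 1) (hP : 1 ≤ P) (hE : 0 ≤ E) :
    (1 + α * β * s) * ((1 - β * (1 - s / 4)) * P * E) + α * β * s * E
      ≤ (1 - β * (1 - s / 2)) * P * E := by
  have hP0 : 0 < P := by linarith
  have hc0 : 0 ≤ 1 - β * (1 - s / 4) := by nlinarith
  have hc1 : 1 - β * (1 - s / 4) ≤ 1 := by nlinarith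
  have hPE : 0 ≤ P * E := by positivity
  have hM : 0 ≤ α * β * s * P * E := by positivity
  have h3 : (1 - β * (1 - s / 4)) * (α * β * s * P * E) ≤ α * β * s * P * E := by
    calc (1 - β * (1 - s / 4)) * (α * β * s * P * E) ≤ 1 * (α * β * s * P * E) :=
          mul_le_mul_of_nonneg_right hc1 hM
      _ = α * β * s * P * E := one_mul _
  have h4 : α * β * s * E ≤ α * β * s * P * E := by
    have h0 : 0 ≤ α * β * s * E := by positivity
    nlinarith
  have h5 : (1 - β * (1 - s / 4) + 2 * α * β * s) * (P * E) ≤ (1 - β * (1 - s / 2)) * (P * E) := by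
    apply mul_le_mul_of_nonneg_right _ hPE
    have hq : 0 ≤ β * s * (1 / 4 - 2 * α) :=
      mul_nonneg (mul_nonneg hβ0 hs0) (by linarith)
    linarith [hq, zline_margin_eq α β s]
  calc (1 + α * β * s) * ((1 - β * (1 - s / 4)) * P * E) + α * β * s * E
      = (1 - β * (1 - s / 4)) * P * E + (1 - β * (1 - s / 4)) * (α * β * s * P * E)
          + α * β * s * E := by ring
    _ ≤ (1 - β * (1 - s / 4)) * P * E + α * β * s * P * E + α * β * s * P * E := by linarith
    _ = (1 - β * (1 - s / 4) + 2 * α * β * s) * (P * E) := by ring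
    _ ≤ (1 - β * (1 - s / 2)) * (P * E) := h5
    _ = (1 - β * (1 - s / 2)) * P * E := by ring

/-- **Z″ RUNG TRANSFER RATIO** `θ_u∕(a θ_v) = (1 − β(1 − s/2))∕((1 + αβs)(1 − β(1 − s/4))) ≤ 1 + s/4` for print's
`0 < β ≤ 1/2` ([LF-I] p.182 «0 < β ≤ 1/2 … we can take β = 1/2»), any `α ≥ 0`, `s ≥ 0`. [folklore] -/
theorem zrung_ratio_le {α β s : ℝ} (hα : 0 ≤ α) (hβ0 : 0 ≤ β) (hβ : β ≤ 1 / 2) (hs0 : 0 ≤ s) :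
    (1 - β * (1 - s / 2)) / ((1 + α * β * s) * (1 - β * (1 - s / 4))) ≤ 1 + s / 4 := by
  have h2 : 0 < 1 - β * (1 - s / 4) := by nlinarith
  have h1 : 0 < 1 + α * β * s := by positivity
  have hden : 0 < (1 + α * β * s) * (1 - β * (1 - s / 4)) := mul_pos h1 h2
  rw [div_le_iff₀ hden]
  have hαβs : 0 ≤ α * β * s := by positivity
  have hA : (1 + s / 4) * (1 - β * (1 - s / 4)) ≤ (1 + s / 4) * ((1 + α * β * s) * (1 - β * (1 - s / 4))) := by
    have h3 : 0 ≤ 1 + s / 4 := by linarith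
    have h4 : 1 * (1 - β * (1 - s / 4)) ≤ (1 + α * β * s) * (1 - β * (1 - s / 4)) :=
      mul_le_mul_of_nonneg_right (by linarith) h2.le
    calc (1 + s / 4) * (1 - β * (1 - s / 4)) = (1 + s / 4) * (1 * (1 - β * (1 - s / 4))) := by ring
      _ ≤ (1 + s / 4) * ((1 + α * β * s) * (1 - β * (1 - s / 4))) := mul_le_mul_of_nonneg_left h4 h3
  have hB : 1 - β * (1 - s / 2) ≤ (1 + s / 4) * (1 - β * (1 - s / 4)) := by
    have h5 : 0 ≤ s * (1 / 4 - β / 2) := mul_nonneg hs0 (by linarith)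
    have h6 : 0 ≤ β * (s * s) := mul_nonneg hβ0 (mul_nonneg hs0 hs0)
    nlinarith [h5, h6]
  linarith [hA, hB]

/-- **THE LADDER PRODUCT IS BOUNDED**: `∏_{d < n} (1 + t·2^{−d}) ≤ e^{2t}` (`t ≥ 0`) — iterating the rung transfer
along the whole Z″ ladder (ratios `≤ 1 + 2^{−d}/4`, `t = 1/4`) multiplies the (M1) constant by at most `e^{1/2}`,
uniformly in the ladder length (hence in `k`, `N₀(k)` and the window). [folklore] -/
theorem prod_one_add_geom_le_exp {t : ℝ} (ht : 0 ≤ t) (n : ℕ) :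
    ∏ d ∈ Finset.range n, (1 + t * (1 / 2 : ℝ) ^ d) ≤ Real.exp (2 * t) := by
  calc ∏ d ∈ Finset.range n, (1 + t * (1 / 2 : ℝ) ^ d)
      ≤ ∏ d ∈ Finset.range n, Real.exp (t * (1 / 2 : ℝ) ^ d) := by
        apply Finset.prod_le_prod
        · intro d _; positivity
        · intro d _
          have := Real.add_one_le_exp (t * (1 / 2 : ℝ) ^ d)
          linarith
    _ = Real.exp (∑ d ∈ Finset.range n, t * (1 / 2 : ℝ) ^ d) := by rw [Real.exp_sum]
    _ ≤ Real.exp (2 * t) := by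
        apply Real.exp_le_exp.mpr
        rw [← Finset.mul_sum]
        have hgeom : ∑ d ∈ Finset.range n, (1 / 2 : ℝ) ^ d ≤ 2 := sum_geometric_two_le n
        nlinarith [hgeom]

/-- **THE Z″ RUNG, ASSEMBLED** (print's `α = 1/8` allowed): on a term law carried by `S` (where the
level-`(n+1)` letter `v < θ_v` and (1.48) hold), (M1) for the NEWER statistic `v = |U^{(n+1)}(∂p) − 1|` at depth
`θ_u ρ∕(a θ_v)` with constant `D` gives (M1) for the OLDER (implied) statistic `u = |U^{(n)}(∂p) − 1|` at depth `ρ`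
with constant `D·θ_u∕(a θ_v) ≤ D(1 + s/4)`. [folklore] -/
theorem slotAntiConcentration_zrung {X : Type*} [MeasurableSpace X] {μ : Measure X} (u v : X → ℝ)
    {S : Set X} {α β s P E ρ D : ℝ} (hα : 0 ≤ α) (hα8 : α ≤ 1 / 8) (hβ0 : 0 < β) (hβ : β ≤ 1 / 2)
    (hs0 : 0 ≤ s) (hs1 : s ≤ 1) (hP : 1 ≤ P) (hE : 0 < E) (hρ : 0 ≤ ρ) (hD : 0 ≤ D) (hS : μ Sᶜ = 0)
    (h148 : ∀ x ∈ S, v x < (1 - β * (1 - s / 4)) * P * E ∧ B15.BasicStep.Ineq148 (u x) (v x) α β s E)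
    (hv : SlotAntiConcentration μ v ((1 - β * (1 - s / 4)) * P * E)
      ((1 - β * (1 - s / 2)) * P * E * ρ / ((1 + α * β * s) * ((1 - β * (1 - s / 4)) * P * E))) D) :
    SlotAntiConcentration μ u ((1 - β * (1 - s / 2)) * P * E) ρ (D * (1 + s / 4)) := by
  have ha : 0 < 1 + α * β * s := by positivity
  have hP0 : 0 < P := by linarith
  have hc : 0 < 1 - β * (1 - s / 4) := by nlinarith
  have hθv : 0 < (1 - β * (1 - s / 4)) * P * E := by positivity
  have himp : ∀ x ∈ S, v x < (1 - β * (1 - s / 4)) * P * E ∧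
      u x ≤ (1 + α * β * s) * v x + α * β * s * E := by
    intro x hx
    obtain ⟨h1, h2⟩ := h148 x hx
    unfold B15.BasicStep.Ineq148 at h2
    exact ⟨h1, by linarith⟩
  have hm := zrung_affine_margin hα hα8 hβ0.le (by linarith) hs0 hs1 hP hE.le
  have h1 := slotAntiConcentration_of_affine_implication u v ha hθv himp hm hS hv
  refine T4ShellMeasureFibre.slotAntiConcentration_mono hρ ?_ h1
  have hratio : (1 - β * (1 - s / 2)) * P * E / ((1 + α * β * s) * ((1 - β * (1 - s / 4)) * P * E))
      = (1 - β * (1 - s / 2)) / ((1 + α * β * s) * (1 - β * (1 - s / 4))) := by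
    have hPne : P ≠ 0 := hP0.ne'
    have hEne : E ≠ 0 := hE.ne'
    have hcne : 1 - β * (1 - s / 4) ≠ 0 := hc.ne'
    have hane : 1 + α * β * s ≠ 0 := ha.ne'
    field_simp
  rw [hratio]
  exact mul_le_mul_of_nonneg_left (zrung_ratio_le hα hβ0.le hβ hs0) hD

end Summit.QuantumFields.YangMills.Theorems.N21ImpliedLetters
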